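import Summits.QuantumFields.BalabanUV.Beta.FP.TowerDoorGaugeBoundG
import Summits.QuantumFields.BalabanUV.Beta.FP.TowerDoorGaugeLatticeSumG
import Summits.QuantumFields.BalabanUV.Beta.FP.TowerDoorGaugeTheta

/-!
# `BalabanUV.Beta.FP.TowerDoorGaugeThetaG` — row D1 ∕ (C1) OWNER «beta-an2», PART 85, ROUTE T (β1), v11 (R-root): **PART 60 `TowerDoorGaugeTheta` OVER `Q`** — LEMMA U ⇒ `hΘ`'s analytic
# core for `lamZG Lc Q …`: the `ℓ¹` pairing of the lattice gauge function summed over the sources vanishes for a decaying chart whose source sums vanish, and the record's chart instance under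
# the displayed two-block letter (TB) `hQ` (PART 84's LEMMA U); PART 60 line for line with `lamZ ↦ lamZG Lc Q`
# (β-function cell `pub-balaban`, BINDER-OWNERS row D1; FINDING AN2-82-1, road A-4 l.69064)

WHAT ([folklore] BY NAME; no `def`, no `def … : Prop`, nothing cited, 0 sorry): §1 `summable_abs_mul_lamZG_prod`, `tsum_tsum_mul_lamZG_eq_zero`, `tsum_tsum_lamZG_mul_eq_zero` (PART 83's bound +
lit `summable_exp_shift′ ∕ tsum_exp_shift′`); §2 `tsum_tsum_mul_lamZG_record_eq_zero`, `summable_abs_mul_lamZG_record_prod` (under `hQ`).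
WHAT THIS IS NOT: nothing of v10 ∕ the END of record moves; nothing of Bałaban's asserted, valued or discharged; 0 estimates beyond [folklore] bookkeeping; 0∕4 row-D1 binders
(hW, hR, D1Tel, D1Rep); ROOT M‴ p325680 ∕ P5c ∕ D6 untouched; NOT (C1), NOT (T-ID), NOT D1, NEVER «G-an2-4 closed», NOT BetaPertH, NOT continuum, NOT Clay.

HONEST DEPENDENCY (page 1, mandatory): continuum YM on T⁴ ⇐ BetaPertH ∧ nine spine estimates (0/9 proved); BetaPertH ⇐ (D1) ∧ (D4) ∧ CAP+tail;
G-an2-4 gates asym, D1 and NE2/3/4.  HONEST FRAMING (cell contract, verbatim): «discharging `BetaPertH` makes Bałaban's UV stability UNCONDITIONAL —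
a real constructive-QFT result; it is NOT the continuum limit and NOT the Clay problem.»  ABSOLUTE RULE (cell charter, verbatim): «No internally-minted
statement may enter as a cited fact. Every hypothesis is either kernel-proved in this package or a verbatim quotation of a PUBLISHED theorem with page
reference. The manuscript(s) under audit are NOT citable for their own disputed steps — they are the thing under adjudication; programme-internal
(2001/route/tribunal) claims are never citable.»  Row D1 ∕ (C1) OWNER «beta-an2», b2b-balaban-beta-an2 gen 82, 2026-08-29.  No existing file touched.
-/



noncomputable section

open Finset
open scoped BigOperators
open Literature.MathematicalPhysics.QuantumFieldTheory
open Literature.MathematicalPhysics.QuantumFieldTheory.Balaban1983to89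
open Literature.MathematicalPhysics.QuantumFieldTheory.Balaban1983to89.Beta
open Literature.MathematicalPhysics.QuantumFieldTheory.Balaban1983to89.B12Sec2to5 (l1 l1_nonneg)
open B5Prop11Plancherel (fine)
open B6Lemma24Torus (pbox)
open AffineAveraging (Site toSite unitVec)
open OneStepResolventKernel (Fib)
open ExpKernelCalculus (MKer Decays Zl Zl_nonneg summable_exp_shift' tsum_exp_shift')
open HessKerRate (scaleK)
open Literature.MathematicalPhysics.QuantumFieldTheory.LatticeForm (quo)
open Summit.QuantumFields.BalabanUV.Beta.CompositeOneShotJetData (Roots AN)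
open Summit.QuantumFields.BalabanUV.Beta.FP.TorusCompositeObjects (bigRatio bigRatio_pos)
open Summit.QuantumFields.BalabanUV.Beta.FP.TorusCompositeObjectsG (StepRows)
open Summit.QuantumFields.BalabanUV.Beta.FP.TowerDoorGaugeRefDefsG (lamZG)
open Summit.QuantumFields.BalabanUV.Beta.FP.TowerDoorGaugeBound (decays_scaleK_AN)
open Summit.QuantumFields.BalabanUV.Beta.FP.TowerDoorGaugeBoundG (exists_abs_lamZG_le_exp)
open Summit.QuantumFields.BalabanUV.Beta.FP.TowerDoorGaugeLatticeSumG (tsum_lamZG_sources_record)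

namespace Summit.QuantumFields.BalabanUV.Beta.FP.TowerDoorGaugeThetaG

variable {d : ℕ}

/-! ## §1 Kernel-generic: the `ℓ¹` pairing summed over the sources -/

section Generic

variable (Lc : ℕ) [NeZero Lc] (Q : StepRows d Lc) (lev : ℕ → ℕ) (rs : ℕ → (Fin (d + 1) → ℕ))
  (hrs : ∀ k i, 0 ≤ toSite (rs k) i ∧ toSite (rs k) i < (Lc : ℤ)) (n : ℕ)

/-- [folklore] **`summable_abs_mul_lamZG_prod`** — for a `δ`-decaying chart (`0 < δ`) and an absolutely summable weight `ω`, the double family `(z, u) ↦ ω u · lamZG … μ z u` is absolutely summable on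
`Site × Site` (dominated by `|ω u|·K·e^{−δ|L•z − u|₁}`; the source map `z ↦ L•z` is injective, so each `z`-fibre is a sub-series of the lattice constant `Zl δ`). -/
theorem summable_abs_mul_lamZG_prod {A : MKer (d + 1) (Fib d)} {C δ : ℝ} (hA : Decays A C δ) (hδ : 0 < δ)
    (ω : Site (d + 1) → ℝ) (hω : Summable (fun u => |ω u|)) (μ : Fin (d + 1)) :
    Summable (fun p : Site (d + 1) × Site (d + 1) => |ω p.2 * lamZG Lc Q lev rs hrs n A μ p.1 p.2|) := by
  obtain ⟨K, hK, h⟩ := exists_abs_lamZG_le_exp Lc Q lev rs hrs n hA hδ.le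
  have hL : (((bigRatio Lc (n + 1) : ℕ) : ℤ)) ≠ 0 := by exact_mod_cast (bigRatio_pos Lc (Nat.pos_of_ne_zero (NeZero.ne Lc)) (n + 1)).ne'
  have hinj : Function.Injective (fun z : Site (d + 1) => (((bigRatio Lc (n + 1) : ℕ) : ℤ)) • z) := smul_right_injective _ hL
  -- the dominating family `g (z, u) := |ω u| · (K · e^{−δ|L•z − u|₁})`, summed `u`-fibrewise over `z`
  set g : Site (d + 1) × Site (d + 1) → ℝ := fun p =>
    |ω p.2| * (K * Real.exp (-δ * l1 ((((bigRatio Lc (n + 1) : ℕ) : ℤ) • p.1) - p.2))) with hg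
  have hg0 : ∀ p, 0 ≤ g p := fun p => mul_nonneg (abs_nonneg _) (mul_nonneg hK (Real.exp_pos _).le)
  have hfib : ∀ u : Site (d + 1), Summable (fun z : Site (d + 1) => K * Real.exp (-δ * l1 ((((bigRatio Lc (n + 1) : ℕ) : ℤ) • z) - u))) :=
    fun u => ((summable_exp_shift' hδ u).comp_injective hinj).mul_left K
  have hfib_le : ∀ u : Site (d + 1), (∑' z : Site (d + 1), K * Real.exp (-δ * l1 ((((bigRatio Lc (n + 1) : ℕ) : ℤ) • z) - u))) ≤ K * Zl (d + 1) δ := by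
    intro u
    rw [tsum_mul_left]
    refine mul_le_mul_of_nonneg_left ?_ hK
    rw [← tsum_exp_shift' (c := δ) u]
    exact tsum_comp_le_tsum_of_inj (summable_exp_shift' hδ u) (fun y => (Real.exp_pos _).le) hinj
  have hgs : Summable g := by
    -- swap to the `(u, z)` order, where the fibres are the `hfib u`
    have hsw : Summable (fun p : Site (d + 1) × Site (d + 1) => g (Equiv.prodComm _ _ p)) := by
      rw [summable_prod_of_nonneg (fun p => hg0 _)]
      constructor
      · intro u
        simpa [hg] using (hfib u).mul_left (|ω u|)
      · refine Summable.of_nonneg_of_le (fun u => tsum_nonneg fun z => hg0 _) (fun u => ?_) (hω.mul_right (K * Zl (d + 1) δ))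
        simp only [hg, Equiv.prodComm_apply, Prod.swap]
        rw [tsum_mul_left]
        exact mul_le_mul_of_nonneg_left (hfib_le u) (abs_nonneg _)
    exact (Equiv.prodComm (Site (d + 1)) (Site (d + 1))).summable_iff.mp hsw
  refine Summable.of_nonneg_of_le (fun p => abs_nonneg _) (fun p => ?_) hgs
  rw [abs_mul, hg]
  exact mul_le_mul_of_nonneg_left (h μ p.1 p.2) (abs_nonneg _)

/-- [folklore] **`tsum_tsum_mul_lamZG_eq_zero` — LEMMA U's ANALYTIC CORE**: for a `δ`-decaying chart (`0 < δ`), an absolutely summable weight `ω`, and vanishing sitewise source sums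
`∀ u, Σ'_z lamZG … μ z u = 0` (PART 58), the `ℓ¹` pairing summed over the sources vanishes: `Σ'_z Σ'_u ω u · lamZG … μ z u = 0` (Fubini `tsum_comm'` over §1's domination). -/
theorem tsum_tsum_mul_lamZG_eq_zero {A : MKer (d + 1) (Fib d)} {C δ : ℝ} (hA : Decays A C δ) (hδ : 0 < δ)
    (ω : Site (d + 1) → ℝ) (hω : Summable (fun u => |ω u|)) (μ : Fin (d + 1))
    (hzero : ∀ u : Site (d + 1), (∑' z : Site (d + 1), lamZG Lc Q lev rs hrs n A μ z u) = 0) :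
    (∑' z : Site (d + 1), ∑' u : Site (d + 1), ω u * lamZG Lc Q lev rs hrs n A μ z u) = 0 := by
  have hs : Summable (fun p : Site (d + 1) × Site (d + 1) => ω p.2 * lamZG Lc Q lev rs hrs n A μ p.1 p.2) :=
    (summable_abs_mul_lamZG_prod Lc Q lev rs hrs n hA hδ ω hω μ).of_abs
  have hunc : Summable (Function.uncurry fun (z u : Site (d + 1)) => ω u * lamZG Lc Q lev rs hrs n A μ z u) := hs
  have h1 : ∀ z : Site (d + 1), Summable (fun u : Site (d + 1) => ω u * lamZG Lc Q lev rs hrs n A μ z u) := fun z => hs.prod_factor z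
  have h2 : ∀ u : Site (d + 1), Summable (fun z : Site (d + 1) => ω u * lamZG Lc Q lev rs hrs n A μ z u) := fun u => hs.prod_symm.prod_factor u
  calc (∑' z : Site (d + 1), ∑' u : Site (d + 1), ω u * lamZG Lc Q lev rs hrs n A μ z u)
      = ∑' u : Site (d + 1), ∑' z : Site (d + 1), ω u * lamZG Lc Q lev rs hrs n A μ z u := (hunc.tsum_comm' h1 h2).symm
    _ = ∑' u : Site (d + 1), ω u * ∑' z : Site (d + 1), lamZG Lc Q lev rs hrs n A μ z u := by
        refine tsum_congr fun u => ?_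
        rw [tsum_mul_left]
    _ = 0 := by simp [hzero]

/-- [folklore] the same with the weight on the right: `Σ'_z Σ'_u lamZG … μ z u · ω u = 0`. -/
theorem tsum_tsum_lamZG_mul_eq_zero {A : MKer (d + 1) (Fib d)} {C δ : ℝ} (hA : Decays A C δ) (hδ : 0 < δ)
    (ω : Site (d + 1) → ℝ) (hω : Summable (fun u => |ω u|)) (μ : Fin (d + 1))
    (hzero : ∀ u : Site (d + 1), (∑' z : Site (d + 1), lamZG Lc Q lev rs hrs n A μ z u) = 0) :
    (∑' z : Site (d + 1), ∑' u : Site (d + 1), lamZG Lc Q lev rs hrs n A μ z u * ω u) = 0 := by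
  have e : ∀ z u : Site (d + 1), lamZG Lc Q lev rs hrs n A μ z u * ω u = ω u * lamZG Lc Q lev rs hrs n A μ z u := fun z u => mul_comm _ _
  simp_rw [e]
  exact tsum_tsum_mul_lamZG_eq_zero Lc Q lev rs hrs n hA hδ ω hω μ hzero

end Generic

/-! ## §2 The record's chart -/

section Record

variable {Lc : ℕ} [NeZero Lc] (Q : StepRows 3 Lc)
  (hQ : ∀ (M : Fin (3 + 1) → ℕ) [∀ μ, NeZero (M μ)] (ℓ : ℕ) (r : Fin (3 + 1) → ℕ) (a : ↥(pbox M)) (ν : Fin (3 + 1))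
      (b : ↥(pbox (fine Lc M))) (κ : Fin (3 + 1)),
      (a : Site (3 + 1)) + unitVec ν ∈ pbox M → Q M ℓ r (a, ν) (b, κ) ≠ 0 →
        (quo Lc (b : Site (3 + 1)) = a ∨ quo Lc (b : Site (3 + 1)) = (a : Site (3 + 1)) + unitVec ν) ∧
        (quo Lc ((b : Site (3 + 1)) + unitVec κ) = a ∨ quo Lc ((b : Site (3 + 1)) + unitVec κ) = (a : Site (3 + 1)) + unitVec ν))
  (R : Roots Lc) (lev : ℕ → ℕ) (rs : ℕ → (Fin (3 + 1) → ℕ))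
  (hrs : ∀ k i, 0 ≤ toSite (rs k) i ∧ toSite (rs k) i < (Lc : ℤ)) (n : ℕ) (σ : Fib 3 → ℝ)
include hQ

/-- [folklore] **`tsum_tsum_mul_lamZG_record_eq_zero` — FOR THE RECORD's CHART, EVERY `ℓ¹` PAIRING OF `λℤ` SUMMED OVER THE SOURCES VANISHES**:
`Σ'_z Σ'_u ω u · lamZG Lc Q lev rs hrs n (scaleK σ σ (AN R (n+1))) μ z u = 0` for every absolutely summable `ω` (PART 59 `decays_scaleK_AN`, PART 58 `tsum_lamZG_sources_record`). -/
theorem tsum_tsum_mul_lamZG_record_eq_zero (ω : Site (3 + 1) → ℝ) (hω : Summable (fun u => |ω u|)) (μ : Fin (3 + 1)) :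
    (∑' z : Site (3 + 1), ∑' u : Site (3 + 1), ω u * lamZG Lc Q lev rs hrs n (scaleK σ σ (AN R (n + 1))) μ z u) = 0 := by
  obtain ⟨δ, C, hδ, _, hA⟩ := decays_scaleK_AN R σ (n + 1)
  exact tsum_tsum_mul_lamZG_eq_zero Lc Q lev rs hrs n hA hδ ω hω μ (fun u => tsum_lamZG_sources_record Q hQ R lev rs hrs n σ μ u)

omit hQ in
/-- [folklore] the double family is absolutely summable for the record's chart (for the door's later Fubini steps). -/
theorem summable_abs_mul_lamZG_record_prod (ω : Site (3 + 1) → ℝ) (hω : Summable (fun u => |ω u|)) (μ : Fin (3 + 1)) :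
    Summable (fun p : Site (3 + 1) × Site (3 + 1) => |ω p.2 * lamZG Lc Q lev rs hrs n (scaleK σ σ (AN R (n + 1))) μ p.1 p.2|) := by
  obtain ⟨δ, C, hδ, _, hA⟩ := decays_scaleK_AN R σ (n + 1)
  exact summable_abs_mul_lamZG_prod Lc Q lev rs hrs n hA hδ ω hω μ

end Record

end Summit.QuantumFields.BalabanUV.Beta.FP.TowerDoorGaugeThetaG

end
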